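import Mathlib
import HarnessLib
import Literature.MathematicalPhysics.QuantumLattice.GaugeGroups
import Literature.MathematicalPhysics.QuantumFieldTheory.ConstructiveQFTWave0
import Literature.MathematicalPhysics.QuantumFieldTheory.UnitaryCayleyChart
import Summits.Ventures.LatticeQCDFlow.Scaling.LatticeEntropy
import Summits.Ventures.LatticeQCDFlow.Scaling.LatticeEntropyGrowthSharp

/-!
# LatticeQCDFlow / Scaling — the `U(N)` instance of the entropy-growth law (R-T2-10, one-plaquette inputs)

HONEST FRAMING: exact (Metropolis-corrected) sampling algorithms for lattice gauge theory; figures of merit are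
autocorrelation/cost numbers at stated couplings and volumes; no continuum-physics claim.

Venture `LatticeQCDFlow` (cell pub-lqcd), topic `Scaling`, FANOUT row 30 (lean-1) — OUR WORK.  The tree's
`EntropyGrowth d κ` (`Scaling/LatticeEntropy.lean`; proved as `entropyGrowth`, `Scaling/LatticeEntropyGrowthSharp.lean`)
is the two-sided `V·log β` law for the relative entropy of the Wilson measure with respect to the product Haar
prior, CONDITIONAL on two one-plaquette inputs (H1) `Z₁(β) ≤ A·β^{-κ/2}` and (H2) small balls of Haar mass
`≥ a·ε^κ` with four-fold plaquette action `≤ b·ε²`.  Its docstring names the expected exponent `κ = N²` for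
`U(N)`.  This file PROVES both inputs for the unitary group `U(N) = Matrix.unitaryGroup (Fin N) ℂ` in its
defining representation `unitaryFundamentalRep (Fin N) ℂ` (`GaugeGroups.lean`), for EVERY `N`, with `κ = N²`:

* §1 `haar_gball_ge`, `haar_gball_le`: the Haar probability of the Hilbert–Schmidt balls
  `B(1, δ) = {U : ‖U - 1‖_F ≤ δ}` (`UnitaryCayley.gball`) is `≍ δ^{N²}`: `a·δ^{N²} ≤ σ(B(1,δ))` for
  `0 < δ ≤ 1` (the tree's `UnitaryCayley.exists_haar_gball_ge`) and `σ(B(1,δ)) ≤ A·δ^{N²}` for all `δ > 0`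
  (from the tree's Cayley-chart comparison `UnitaryCayley.chartMeasure_le` and ball squeeze
  `UnitaryCayley.haar_gball_le_chartMeasure_closedBall`, `κ(1/2) = 5/2`);
* §2 the plaquette action is `N - Re tr U = ‖U - 1‖²_F/2` (`UnitaryCayley.re_trace_one_sub`), so the action
  balls `{N - Re tr U ≤ t}` ARE the Hilbert–Schmidt balls `B(1, √(2t))`;
* §3 (H2) `smallBall_un`: `B_ε = B(1, ε)`, mass `≥ a·ε^{N²}`, four-fold action `≤ 8ε²`
  (`UnitaryCayley.norm_one_sub_prod_le`, `norm_one_sub_inv`);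
* §4 (H1) `onePlaquetteZ_un_le`: `Z₁(β) ≤ A'·β^{-N²/2}` for `β > 0`, by the shell bound
  `e^{-βs} ≤ Σ_k e^{-k}·1{s ≤ (k+1)/β}` summed against the ball volumes (the argument of theory-2's
  `SUN.onePlaquetteDecay_of_haarActionBallUpper`, here for `U(N)`).

* §5 `EntropyGrowthLaw d N` (typed item) and `entropyGrowthLaw : EntropyGrowthLaw d N` for EVERY `d, N`: the
  assembly with `entropyGrowth d (N²)` (`Scaling/LatticeEntropyGrowthSharp.lean`) — the unconditional two-sided
  `N²·((d-1)/2)·L^d·log β` law for `U(N)` lattice gauge theory.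

Elementary; nothing here is cited as a fact (the Chatterjee-§6/§11 infrastructure used is PROVED in
the tree, `UnitaryCayleyChart.lean`).
-/

noncomputable section

open scoped Matrix.Norms.Frobenius ENNReal NNReal
open MeasureTheory Metric Set
open Literature.MathematicalPhysics.QuantumFieldTheory
open Literature.MathematicalPhysics.QuantumFieldTheory.UnitaryCayley
open Literature.MathematicalPhysics.QuantumLattice (unitaryFundamentalRep unitaryFundamentalRep_apply
  continuous_unitaryFundamentalRep)

namespace Summit.Ventures.LatticeQCDFlow.Theory2.Lattice.UN

variable {N : ℕ}

/-! ## §1. Haar volume of Hilbert–Schmidt balls in `U(N)`: two-sided `δ^{N²}` -/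

/-- **Lower volume bound** (real form of the tree's `UnitaryCayley.exists_haar_gball_ge`): there is `a > 0`
with `a·δ^{N²} ≤ σ(B(1,δ))` for `0 < δ ≤ 1`. [folklore] -/
theorem haar_gball_ge : ∃ a : ℝ, 0 < a ∧ ∀ δ : ℝ, 0 < δ → δ ≤ 1 →
    a * δ ^ (N * N) ≤ (haarProbability (𝔾 N) (gball N δ)).toReal := by
  obtain ⟨C, hC, h⟩ := exists_haar_gball_ge (N := N)
  exact ⟨C, hC, fun δ hδ hδ1 =>
    (ENNReal.ofReal_le_iff_le_toReal (measure_ne_top _ _)).1 (h δ hδ hδ1)⟩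

/-- `κ(1/2) = 5/2` for the chart distortion factor of `UnitaryCayleyChart`. [folklore] -/
theorem κ_half : κ (1 / 2) = 5 / 2 := by norm_num [κ]

/-- **Upper volume bound near `1`**: for `0 ≤ δ ≤ 1/5`,
`σ(B(1,δ)) ≤ c_N · (5δ/2)^{N²} · vol b(0,1)` — the ball `B(1, δ) = B(1, (5δ/2)/κ(1/2))` lies in the
chart image of `b(0, 5δ/2)` (`5δ/2 ≤ 1/2`), whose chart measure is at most `c_N` times its volume.
[folklore] -/
theorem haar_gball_le_of_le {δ : ℝ} (hδ : 0 ≤ δ) (hδ5 : δ ≤ 1 / 5) :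
    haarProbability (𝔾 N) (gball N δ) ≤
      haarChartConst N * (ENNReal.ofReal ((5 / 2 * δ) ^ (N * N)) * volume (closedBall (0 : 𝔼 N) 1)) := by
  have hsub : gball N δ ⊆ gball N ((5 / 2 * δ) / κ (1 / 2)) :=
    gball_mono (by rw [κ_half]; field_simp; rfl)
  have h2 := haar_gball_le_chartMeasure_closedBall (N := N) (r := 1 / 2) (δ := 5 / 2 * δ) le_rfl
    (a := 0) (by rw [norm_zero]; norm_num) (by positivity) (by linarith)
  calc haarProbability (𝔾 N) (gball N δ)
      ≤ haarProbability (𝔾 N) (gball N ((5 / 2 * δ) / κ (1 / 2))) := measure_mono hsub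
    _ ≤ chartMeasure N (closedBall 0 (5 / 2 * δ)) := h2
    _ ≤ haarChartConst N * volume (closedBall (0 : 𝔼 N) (5 / 2 * δ)) := chartMeasure_le _
    _ = _ := by rw [volume_closedBall_𝔼 _ (by positivity)]

/-- **Upper volume bound**: there is `A > 0` with `σ(B(1,δ)) ≤ A·δ^{N²}` for ALL `δ > 0` (the chart bound for
`δ ≤ 1/5`; `σ ≤ 1 ≤ (5δ)^{N²}` beyond). [folklore] -/
theorem haar_gball_le : ∃ A : ℝ, 0 < A ∧ ∀ δ : ℝ, 0 < δ →
    (haarProbability (𝔾 N) (gball N δ)).toReal ≤ A * δ ^ (N * N) := by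
  set V₁ := volume (closedBall (0 : 𝔼 N) 1) with hV₁
  have hV₁fin : V₁ ≠ ∞ := (volume_closedBall_𝔼_lt_top _ _).ne
  set A₀ : ℝ := (haarChartConst N : ℝ) * (5 / 2) ^ (N * N) * V₁.toReal with hA₀_def
  have hA₀ : 0 ≤ A₀ := by positivity
  refine ⟨A₀ + 5 ^ (N * N), by positivity, fun δ hδ => ?_⟩
  have hδN : 0 < δ ^ (N * N) := pow_pos hδ _
  by_cases hδ5 : δ ≤ 1 / 5
  · have h := haar_gball_le_of_le (N := N) hδ.le hδ5
    have hfin : (haarChartConst N : ℝ≥0∞) *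
        (ENNReal.ofReal ((5 / 2 * δ) ^ (N * N)) * volume (closedBall (0 : 𝔼 N) 1)) ≠ ∞ :=
      ENNReal.mul_ne_top ENNReal.coe_ne_top (ENNReal.mul_ne_top ENNReal.ofReal_ne_top hV₁fin)
    have h' := ENNReal.toReal_mono hfin h
    rw [ENNReal.toReal_mul, ENNReal.toReal_mul, ENNReal.toReal_ofReal (by positivity),
      ENNReal.coe_toReal, mul_pow, ← hV₁] at h'
    calc (haarProbability (𝔾 N) (gball N δ)).toReal
        ≤ (haarChartConst N : ℝ) * ((5 / 2) ^ (N * N) * δ ^ (N * N) * V₁.toReal) := h'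
      _ = A₀ * δ ^ (N * N) := by rw [hA₀_def]; ring
      _ ≤ (A₀ + 5 ^ (N * N)) * δ ^ (N * N) := by nlinarith [pow_pos (show (0:ℝ) < 5 by norm_num) (N * N)]
  · rw [not_le] at hδ5
    have h1 : (haarProbability (𝔾 N) (gball N δ)).toReal ≤ 1 := by
      have := prob_le_one (μ := haarProbability (𝔾 N)) (s := gball N δ)
      exact ENNReal.toReal_le_of_le_ofReal zero_le_one (by rwa [ENNReal.ofReal_one])
    have h2 : (1 : ℝ) ≤ (5 * δ) ^ (N * N) := one_le_pow₀ (by linarith)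
    rw [mul_pow] at h2
    nlinarith

/-! ## §2. The plaquette action of `U(N)` is half the squared Hilbert–Schmidt distance to `1` -/

/-- `N - Re tr U = ‖U - 1‖²_F / 2` for `U ∈ U(N)` (Chatterjee Lemma 7.2, tree's
`UnitaryCayley.re_trace_one_sub`). [folklore] -/
theorem action_eq (U : 𝔾 N) :
    (N : ℝ) - (unitaryFundamentalRep (Fin N) ℂ U).trace.re =
      ‖(U : Matrix (Fin N) (Fin N) ℂ) - 1‖ ^ 2 / 2 := by
  rw [unitaryFundamentalRep_apply, ← norm_neg, neg_sub, ← re_trace_one_sub U.2, Matrix.trace_sub,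
    Complex.sub_re, Matrix.trace_one, Fintype.card_fin]
  simp

/-- The plaquette action is non-negative on `U(N)`. [folklore] -/
theorem action_nonneg (U : 𝔾 N) : 0 ≤ (N : ℝ) - (unitaryFundamentalRep (Fin N) ℂ U).trace.re := by
  rw [action_eq]; positivity

/-- `Re tr U ≤ N` on `U(N)` (the hypothesis `Re tr ρ ≤ N` of the entropy-growth law). [folklore] -/
theorem re_trace_le (U : 𝔾 N) : (unitaryFundamentalRep (Fin N) ℂ U).trace.re ≤ (N : ℕ) := by
  have := action_nonneg U; linarith

/-- The plaquette action is continuous on `U(N)`. [folklore] -/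
theorem continuous_action :
    Continuous fun U : 𝔾 N => (N : ℝ) - (unitaryFundamentalRep (Fin N) ℂ U).trace.re := by
  have h : Continuous fun U : 𝔾 N => ‖(U : Matrix (Fin N) (Fin N) ℂ) - 1‖ ^ 2 / 2 :=
    ((continuous_norm_coe_sub (N := N) 1).pow 2).div_const 2
  exact h.congr fun U => (action_eq U).symm

/-- Action balls are measurable. [folklore] -/
theorem measurableSet_actionBall (t : ℝ) :
    MeasurableSet {U : 𝔾 N | (N : ℝ) - (unitaryFundamentalRep (Fin N) ℂ U).trace.re ≤ t} :=
  (isClosed_le continuous_action continuous_const).measurableSet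

/-- **Action balls are Hilbert–Schmidt balls**: `{U : N - Re tr U ≤ t} = B(1, √(2t))` for `t ≥ 0`.
[folklore] -/
theorem actionBall_eq {t : ℝ} (ht : 0 ≤ t) :
    {U : 𝔾 N | (N : ℝ) - (unitaryFundamentalRep (Fin N) ℂ U).trace.re ≤ t} =
      gball N (Real.sqrt (2 * t)) := by
  ext U
  rw [mem_setOf_eq, mem_gball, action_eq]
  have h0 := norm_nonneg ((U : Matrix (Fin N) (Fin N) ℂ) - 1)
  constructor
  · intro h
    calc ‖(U : Matrix (Fin N) (Fin N) ℂ) - 1‖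
        = Real.sqrt (‖(U : Matrix (Fin N) (Fin N) ℂ) - 1‖ ^ 2) := (Real.sqrt_sq h0).symm
      _ ≤ Real.sqrt (2 * t) := Real.sqrt_le_sqrt (by linarith)
  · intro h
    have h2 : ‖(U : Matrix (Fin N) (Fin N) ℂ) - 1‖ ^ 2 ≤ Real.sqrt (2 * t) ^ 2 := pow_le_pow_left₀ h0 h 2
    rw [Real.sq_sqrt (by positivity)] at h2
    linarith

/-! ## §3. (H2) for `U(N)`: small balls -/

/-- Elements of `{1} ∪ B(1,ε) ∪ B(1,ε)⁻¹` are within `ε` of `1` (`‖1 - U⁻¹‖ = ‖1 - U‖`). [folklore] -/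
theorem norm_one_sub_le_of_mem {ε : ℝ} (hε : 0 ≤ ε) {g : 𝔾 N}
    (hg : g ∈ insert (1 : 𝔾 N) (gball N ε ∪ (gball N ε)⁻¹)) : ‖(1 : Matrix (Fin N) (Fin N) ℂ) - g‖ ≤ ε := by
  rcases Set.mem_insert_iff.1 hg with rfl | hg'
  · simpa using hε
  · rcases hg' with h | h
    · rw [norm_sub_rev]; exact h
    · rw [Set.mem_inv] at h
      rw [← inv_inv g, norm_one_sub_inv, norm_sub_rev]; exact h

/-- **Four-fold products from `{1} ∪ B(1,ε) ∪ B(1,ε)⁻¹` have plaquette action `≤ 8ε²`**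
(`‖1 - g₁g₂g₃g₄‖ ≤ 4ε` by `UnitaryCayley.norm_one_sub_prod_le`, and §2). [folklore] -/
theorem action_fourfold_le {ε : ℝ} (hε : 0 ≤ ε) {g₁ g₂ g₃ g₄ : 𝔾 N}
    (h₁ : g₁ ∈ insert (1 : 𝔾 N) (gball N ε ∪ (gball N ε)⁻¹))
    (h₂ : g₂ ∈ insert (1 : 𝔾 N) (gball N ε ∪ (gball N ε)⁻¹))
    (h₃ : g₃ ∈ insert (1 : 𝔾 N) (gball N ε ∪ (gball N ε)⁻¹))
    (h₄ : g₄ ∈ insert (1 : 𝔾 N) (gball N ε ∪ (gball N ε)⁻¹)) :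
    (N : ℝ) - (unitaryFundamentalRep (Fin N) ℂ (g₁ * g₂ * g₃ * g₄)).trace.re ≤ 8 * ε ^ 2 := by
  rw [action_eq]
  have h := norm_one_sub_prod_le [g₁, g₂, g₃, g₄]
  simp only [List.prod_cons, List.prod_nil, mul_one, List.map_cons, List.map_nil, List.sum_cons,
    List.sum_nil, add_zero] at h
  have e : g₁ * g₂ * g₃ * g₄ = g₁ * (g₂ * (g₃ * g₄)) := by simp only [mul_assoc]
  have h4 : ‖((g₁ * g₂ * g₃ * g₄ : 𝔾 N) : Matrix (Fin N) (Fin N) ℂ) - 1‖ ≤ 4 * ε := by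
    rw [norm_sub_rev, e]
    linarith [norm_one_sub_le_of_mem hε h₁, norm_one_sub_le_of_mem hε h₂,
      norm_one_sub_le_of_mem hε h₃, norm_one_sub_le_of_mem hε h₄]
  have h0 := norm_nonneg (((g₁ * g₂ * g₃ * g₄ : 𝔾 N) : Matrix (Fin N) (Fin N) ℂ) - 1)
  nlinarith

/-- `ε^{N²}` as a real power equals the monoid power `ε^{N·N}`. [folklore] -/
theorem rpow_sq_eq_pow (ε : ℝ) : ε ^ ((N : ℝ) ^ 2) = ε ^ (N * N) := by
  rw [show ((N : ℝ) ^ 2) = ((N * N : ℕ) : ℝ) by push_cast; ring, Real.rpow_natCast]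

/-- **(H2) for `U(N)`**, in the exact form consumed by `EntropyGrowth` (`κ = N²`, `B_ε = B(1,ε)`, `b = 8`).
[folklore] -/
theorem smallBall_un :
    ∃ a b : ℝ, 0 < a ∧ ∀ ε : ℝ, 0 < ε → ε ≤ 1 → ∃ B : Set (𝔾 N), MeasurableSet B ∧
      a * ε ^ ((N : ℝ) ^ 2) ≤ (haarProbability (𝔾 N) B).toReal ∧
      ∀ g₁ ∈ insert (1 : 𝔾 N) (B ∪ B⁻¹), ∀ g₂ ∈ insert (1 : 𝔾 N) (B ∪ B⁻¹),
        ∀ g₃ ∈ insert (1 : 𝔾 N) (B ∪ B⁻¹), ∀ g₄ ∈ insert (1 : 𝔾 N) (B ∪ B⁻¹),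
          ((N : ℕ) : ℝ) - (unitaryFundamentalRep (Fin N) ℂ (g₁ * g₂ * g₃ * g₄)).trace.re ≤ b * ε ^ 2 := by
  obtain ⟨a, ha, hvol⟩ := haar_gball_ge (N := N)
  refine ⟨a, 8, ha, fun ε hε hε1 => ⟨gball N ε, measurableSet_gball ε, ?_,
    fun _ h₁ _ h₂ _ h₃ _ h₄ => action_fourfold_le hε.le h₁ h₂ h₃ h₄⟩⟩
  rw [rpow_sq_eq_pow ε]
  exact hvol ε hε hε1

/-! ## §4. (H1) for `U(N)`: one-plaquette decay `Z₁(β) ≤ A·β^{-N²/2}` -/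

/-- **Volume of action balls**: `σ{N - Re tr U ≤ t} ≤ A·2^{N²/2}·t^{N²/2}` for `t > 0`. [folklore] -/
theorem haar_actionBall_le : ∃ A : ℝ, 0 ≤ A ∧ ∀ t : ℝ, 0 < t →
    (haarProbability (𝔾 N)
        {U : 𝔾 N | (N : ℝ) - (unitaryFundamentalRep (Fin N) ℂ U).trace.re ≤ t}).toReal ≤
      A * t ^ ((N : ℝ) ^ 2 / 2) := by
  obtain ⟨A, hA, hvol⟩ := haar_gball_le (N := N)
  refine ⟨A * 2 ^ ((N : ℝ) ^ 2 / 2), by positivity, fun t ht => ?_⟩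
  rw [actionBall_eq ht.le]
  have h := hvol (Real.sqrt (2 * t)) (Real.sqrt_pos.2 (by positivity))
  have e : Real.sqrt (2 * t) ^ (N * N) = 2 ^ ((N : ℝ) ^ 2 / 2) * t ^ ((N : ℝ) ^ 2 / 2) := by
    rw [← rpow_sq_eq_pow (Real.sqrt (2 * t)), Real.sqrt_eq_rpow, ← Real.rpow_mul (by positivity),
      Real.mul_rpow (by norm_num) ht.le]
    congr 1 <;> ring_nf
  rw [e] at h
  calc _ ≤ A * (2 ^ ((N : ℝ) ^ 2 / 2) * t ^ ((N : ℝ) ^ 2 / 2)) := h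
    _ = _ := by ring

/-- The shell series `Σ_k e^{-k}(k+1)^a` converges (comparison with `n^p e^{-n}`). [folklore] -/
theorem summable_shell (a : ℝ) (p : ℕ) (hap : a ≤ p) :
    Summable (fun k : ℕ => Real.exp (-(k : ℝ)) * ((k : ℝ) + 1) ^ a) := by
  have h1 : Summable (fun n : ℕ => (n : ℝ) ^ p * Real.exp (-1 * n)) :=
    Real.summable_pow_mul_exp_neg_nat_mul p one_pos
  have h2 : Summable (fun k : ℕ => (((k + 1 : ℕ) : ℝ)) ^ p * Real.exp (-1 * ((k + 1 : ℕ) : ℝ))) :=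
    (summable_nat_add_iff 1).mpr h1
  refine Summable.of_nonneg_of_le (fun k => by positivity) (fun k => ?_) (h2.mul_left (Real.exp 1))
  have hk1 : (1 : ℝ) ≤ (k : ℝ) + 1 := by linarith [(Nat.cast_nonneg k : (0 : ℝ) ≤ k)]
  have hpow : ((k : ℝ) + 1) ^ a ≤ ((k : ℝ) + 1) ^ (p : ℝ) :=
    Real.rpow_le_rpow_of_exponent_le hk1 hap
  rw [Real.rpow_natCast] at hpow
  have hexp : Real.exp (-(k : ℝ)) = Real.exp 1 * Real.exp (-1 * ((k + 1 : ℕ) : ℝ)) := by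
    rw [← Real.exp_add]; congr 1; push_cast; ring
  calc Real.exp (-(k : ℝ)) * ((k : ℝ) + 1) ^ a ≤ Real.exp (-(k : ℝ)) * ((k : ℝ) + 1) ^ p :=
        mul_le_mul_of_nonneg_left hpow (Real.exp_pos _).le
    _ = Real.exp 1 * ((((k + 1 : ℕ) : ℝ)) ^ p * Real.exp (-1 * ((k + 1 : ℕ) : ℝ))) := by
        rw [hexp]; push_cast; ring

/-- **Shell bound**: `e^{-β s(U)} ≤ Σ_k e^{-k}·1{s ≤ (k+1)/β}(U)` (take `k = ⌊β s(U)⌋`). [folklore] -/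
theorem weight_le_tsum {β : ℝ} (hβ : 0 < β) (U : 𝔾 N) :
    ENNReal.ofReal (Real.exp (-(β * ((N : ℝ) - (unitaryFundamentalRep (Fin N) ℂ U).trace.re)))) ≤
      ∑' k : ℕ, ENNReal.ofReal (Real.exp (-(k : ℝ))) *
        {V : 𝔾 N | (N : ℝ) - (unitaryFundamentalRep (Fin N) ℂ V).trace.re ≤
          ((k : ℝ) + 1) / β}.indicator 1 U := by
  set s : ℝ := (N : ℝ) - (unitaryFundamentalRep (Fin N) ℂ U).trace.re with hs_def
  have hs : 0 ≤ s := action_nonneg U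
  set k₀ := ⌊β * s⌋₊ with hk₀
  have h1 : (k₀ : ℝ) ≤ β * s := Nat.floor_le (by positivity)
  have h2 : β * s < k₀ + 1 := Nat.lt_floor_add_one _
  have hmem : U ∈ {V : 𝔾 N | (N : ℝ) - (unitaryFundamentalRep (Fin N) ℂ V).trace.re ≤
      ((k₀ : ℝ) + 1) / β} := by
    rw [Set.mem_setOf_eq, ← hs_def, le_div_iff₀ hβ]; linarith [mul_comm β s]
  refine le_trans ?_ (ENNReal.le_tsum k₀)
  rw [Set.indicator_of_mem hmem, Pi.one_apply, mul_one]
  exact ENNReal.ofReal_le_ofReal (Real.exp_le_exp.mpr (by linarith))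

/-- **(H1) for `U(N)`**: `Z₁(β) ≤ A·β^{-N²/2}` for `β > 0` — the one-plaquette partition function of `U(N)`
decays like `β^{-dim U(N)/2}` (shell bound summed against the ball volumes; the constant is
`A·2^{N²/2}·Σ_k e^{-k}(k+1)^{N²/2}`). [folklore] -/
theorem onePlaquetteZ_un_le :
    ∃ A : ℝ, ∀ β : ℝ, 0 < β →
      onePlaquetteZ (unitaryFundamentalRep (Fin N) ℂ) β ≤ A * β ^ (-((N : ℝ) ^ 2 / 2)) := by
  obtain ⟨A, hA0, hAt⟩ := haar_actionBall_le (N := N)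
  set κ2 : ℝ := (N : ℝ) ^ 2 / 2 with hκ2
  set μ := haarProbability (𝔾 N) with hμ
  set u : ℕ → ℝ := fun k => Real.exp (-(k : ℝ)) * ((k : ℝ) + 1) ^ κ2 with hu
  have hu0 : ∀ k, 0 ≤ u k := fun k => by positivity
  have hus : Summable u :=
    summable_shell κ2 (N ^ 2) (by rw [hκ2]; push_cast; nlinarith [sq_nonneg (N : ℝ)])
  set S := ∑' k, u k with hS
  have hS0 : 0 ≤ S := tsum_nonneg hu0
  refine ⟨A * S, fun β hβ => ?_⟩
  have hB : ∀ k : ℕ, MeasurableSet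
      {V : 𝔾 N | (N : ℝ) - (unitaryFundamentalRep (Fin N) ℂ V).trace.re ≤ ((k : ℝ) + 1) / β} :=
    fun k => measurableSet_actionBall _
  -- integrate the shell bound
  have hint : (∫⁻ U, ENNReal.ofReal (Real.exp
        (-(β * ((N : ℝ) - (unitaryFundamentalRep (Fin N) ℂ U).trace.re)))) ∂μ) ≤
      ∑' k : ℕ, ENNReal.ofReal (Real.exp (-(k : ℝ))) *
        μ {V | (N : ℝ) - (unitaryFundamentalRep (Fin N) ℂ V).trace.re ≤ ((k : ℝ) + 1) / β} := by
    calc (∫⁻ U, ENNReal.ofReal (Real.exp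
          (-(β * ((N : ℝ) - (unitaryFundamentalRep (Fin N) ℂ U).trace.re)))) ∂μ)
        ≤ ∫⁻ U, ∑' k : ℕ, ENNReal.ofReal (Real.exp (-(k : ℝ))) *
            {V : 𝔾 N | (N : ℝ) - (unitaryFundamentalRep (Fin N) ℂ V).trace.re ≤
              ((k : ℝ) + 1) / β}.indicator 1 U ∂μ :=
          lintegral_mono fun U => weight_le_tsum hβ U
      _ = ∑' k : ℕ, ∫⁻ U, ENNReal.ofReal (Real.exp (-(k : ℝ))) *
            {V : 𝔾 N | (N : ℝ) - (unitaryFundamentalRep (Fin N) ℂ V).trace.re ≤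
              ((k : ℝ) + 1) / β}.indicator 1 U ∂μ :=
          lintegral_tsum fun k => ((measurable_one.indicator (hB k)).const_mul _).aemeasurable
      _ = _ := by
          refine tsum_congr fun k => ?_
          rw [lintegral_const_mul _ (measurable_one.indicator (hB k)),
            lintegral_indicator_one (hB k)]
  -- bound each ball volume
  have hterm : ∀ k : ℕ, ENNReal.ofReal (Real.exp (-(k : ℝ))) *
      μ {V | (N : ℝ) - (unitaryFundamentalRep (Fin N) ℂ V).trace.re ≤ ((k : ℝ) + 1) / β} ≤
        ENNReal.ofReal (A * β ^ (-κ2) * u k) := by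
    intro k
    have htk : 0 < ((k : ℝ) + 1) / β := by positivity
    have hμk : μ {V | (N : ℝ) - (unitaryFundamentalRep (Fin N) ℂ V).trace.re ≤ ((k : ℝ) + 1) / β} ≤
        ENNReal.ofReal (A * (((k : ℝ) + 1) / β) ^ κ2) := by
      rw [← ENNReal.ofReal_toReal (measure_ne_top μ _)]
      exact ENNReal.ofReal_le_ofReal (hAt _ htk)
    have hβκ : 0 < β ^ κ2 := Real.rpow_pos_of_pos hβ _
    calc ENNReal.ofReal (Real.exp (-(k : ℝ))) *
          μ {V | (N : ℝ) - (unitaryFundamentalRep (Fin N) ℂ V).trace.re ≤ ((k : ℝ) + 1) / β}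
        ≤ ENNReal.ofReal (Real.exp (-(k : ℝ))) *
            ENNReal.ofReal (A * (((k : ℝ) + 1) / β) ^ κ2) :=
          mul_le_mul_of_nonneg_left hμk bot_le
      _ = ENNReal.ofReal (A * β ^ (-κ2) * u k) := by
          rw [← ENNReal.ofReal_mul (Real.exp_pos _).le]
          congr 1
          simp only [hu]
          rw [Real.div_rpow (by positivity) hβ.le, Real.rpow_neg hβ.le]
          field_simp
  -- sum the series
  have hsum : (∑' k : ℕ, ENNReal.ofReal (A * β ^ (-κ2) * u k)) =
      ENNReal.ofReal (A * β ^ (-κ2) * S) := by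
    have e : (fun k : ℕ => ENNReal.ofReal (A * β ^ (-κ2) * u k)) =
        fun k => ENNReal.ofReal (A * β ^ (-κ2)) * ENNReal.ofReal (u k) := by
      funext k; rw [ENNReal.ofReal_mul (by positivity)]
    rw [e, ENNReal.tsum_mul_left, ← ENNReal.ofReal_tsum_of_nonneg hu0 hus,
      ← ENNReal.ofReal_mul (by positivity)]
  have hfin := hint.trans ((ENNReal.tsum_le_tsum hterm).trans hsum.le)
  calc onePlaquetteZ (unitaryFundamentalRep (Fin N) ℂ) β
      = (∫⁻ U, ENNReal.ofReal (Real.exp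
          (-(β * ((N : ℝ) - (unitaryFundamentalRep (Fin N) ℂ U).trace.re)))) ∂μ).toReal := rfl
    _ ≤ (ENNReal.ofReal (A * β ^ (-κ2) * S)).toReal :=
        ENNReal.toReal_mono ENNReal.ofReal_ne_top hfin
    _ = A * S * β ^ (-κ2) := by rw [ENNReal.toReal_ofReal (by positivity)]; ring

/-! ## §5. The entropy-growth law for `U(N)` lattice gauge theory, unconditionally -/

/-- **Sharp entropy growth of `U(N)` lattice gauge theory** (typed item, OURS; the `U(N)`, `κ = N²` instance
of `EntropyGrowth d κ` of `Scaling/LatticeEntropy.lean` with both one-plaquette hypotheses discharged): there is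
`C = C(d, N)` such that for all `L ≥ 2`, `β ≥ 1`, with `D = D(μ_{Λ,β}^{U(N)} ‖ Haar^{⊗E})` the relative entropy
of the Wilson measure of `U(N)` (defining representation) on `(ℤ/L)^d` with respect to the product Haar prior,
`N²·((d-1)·L^d·(1/2 - 1/L) - 1/2)·log β - C·L^d ≤ D ≤ N²·((d-1)·L^d + 1)/2·log β + C·L^d` — the deficit is
`(n_tr/2)·log β·(1 ± O(1/L)) + O(V)` with `n_tr = N²·(d-1)·L^d` transverse degrees of freedom.  Proved below
(`entropyGrowthLaw`), every `d` and `N`. [folklore] -/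
@[conjecture]
def EntropyGrowthLaw (d N : ℕ) : Prop :=
  ∃ C : ℝ, ∀ (L : ℕ) [NeZero L], 2 ≤ L → ∀ β : ℝ, 1 ≤ β →
    (N : ℝ) ^ 2 * (((d : ℝ) - 1) * (L : ℝ) ^ d * (1 / 2 - 1 / L) - 1 / 2) * Real.log β - C * (L : ℝ) ^ d ≤
        (InformationTheory.klDiv
            (wilsonMeasure (d := d) (L := L) (unitaryFundamentalRep (Fin N) ℂ) β)
            (Measure.pi fun _ : Edge d L => haarProbability (Matrix.unitaryGroup (Fin N) ℂ))).toReal ∧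
      (InformationTheory.klDiv
            (wilsonMeasure (d := d) (L := L) (unitaryFundamentalRep (Fin N) ℂ) β)
            (Measure.pi fun _ : Edge d L => haarProbability (Matrix.unitaryGroup (Fin N) ℂ))).toReal ≤
        (N : ℝ) ^ 2 * ((((d : ℝ) - 1) * (L : ℝ) ^ d + 1) / 2) * Real.log β + C * (L : ℝ) ^ d

/-- **The entropy-growth law for `U(N)`, unconditionally** (OURS; closes `UN.EntropyGrowthLaw d N` for every
`d, N`): `entropyGrowth d (N²)` (theory-2 #18) fed with `onePlaquetteZ_un_le` (H1) and `smallBall_un` (H2).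
[folklore] -/
theorem entropyGrowthLaw (d N : ℕ) : EntropyGrowthLaw d N :=
  entropyGrowth d ((N : ℝ) ^ 2) N (𝔾 N) (unitaryFundamentalRep (Fin N) ℂ)
    (continuous_unitaryFundamentalRep (Fin N) ℂ) re_trace_le onePlaquetteZ_un_le smallBall_un

end Summit.Ventures.LatticeQCDFlow.Theory2.Lattice.UN

end
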